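import Summits.Ventures.HSemireg.Pad4TowerClassScreen
import Summits.Ventures.HSemireg.Pad4TowerPermCovarianceStatic

/-!
# Crux H2 `BlochSeedDiscOne` — negation lens, LINE 8: the REYNOLDS SHADOW ∕ ORBIT-MASS LAW (plan-lens-HodgeAV-negation g8)

HONEST FRAMING. Crux workfile of the lens seat `plan-lens-HodgeAV-negation` (g8; LENSES-v3 «negation», director-hodge req-36) for the
crux H2 = stmt-HodgeConjecture-18881 `Summit.HodgeConjecture.HodgeConjecture.Theses.EightfoldBlochSeeds.BlochSeedDiscOne`. It is KERNEL
ALGEBRA ABOUT THE CENSUS'S OWN BOOKKEEPING (the hsemireg SAT∕LP∕MILP census of first-order designs on 𝔅(μ₄), cell `pub-hsemireg`): an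
abstract averaging ∕ integrality law for a finite group acting on an index set (§1), its class-level instance over the tree's class frame
and 𝔅(μ₄) cells (§2), and the support-level hull (§3, tree). Nothing here is a design, a monad, a sheaf, a SOURCE or a SEED; NOTHING HERE
SAYS THAT HC ∕ HC_CM ∕ HC_AV ∕ H2 (18881) HOLDS OR FAILS — HC_CM is a displayed binder of the route only. No `sorry`, no `axiom`, no
`instance`, no notation, no Literature fact. Machine ≠ kernel ≠ tree theorem: the census rows quoted below are cell data, not theorems.

THE QUESTION (req-36 key «negation (H2)»; director-hodge g21 FINAL § v4 «non-constant» room; g22 R19.257 (4) live rooms R-A…R-E): every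
SAT∕UNSAT∕LP word of the census is computed on ORBIT-CONSTANT designs (one multiplicity per `G₁ = ⟨Δ⟩ × S₄`-orbit of cells, `|G₁| = 96`;
h16-ilp conv A «G = S₄ × μ₄ (diagonal β ↦ iβ)»). What can a design with ARBITRARY cell multiplicities on a `G₁`-closed support do that an
orbit-constant one cannot? THE ANSWER TYPED HERE: at LP level NOTHING, at class level NOTHING up to a scale dividing 96, at integer level
exactly what the ORBIT-MASS relaxation allows.

§1 THE ABSTRACT LAW (finite group `G` on `ι`, designs `ι → ℚ`). The REYNOLDS AVERAGE `avg G m = |G|⁻¹ Σ_g g·m` is orbit-constant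
(`avg_smul`), idempotent, lies in every CONVEX `G`-stable gate containing `m` (`avg_mem_of_convex`, `avg_mem_iInter_of_convex`: linear class
rows, rank row, `m ≥ 1`, `m ≥ 0`, zero-deficit ∕ Hall flow feasibility on `G`-stable strata families, display ∕ (α) ∕ MSIGN LPs — every
LP-level gate of record is convex and `G₁`-stable), keeps every `G`-invariant linear functional (`apply_avg_of_invariant`: μ, rank, m₁, (H1)
coordinates) and kills every semi-invariant one (`apply_avg_eq_zero_of_semi`); FAMILY FORM `avg_mem_iInter_of_permuted` ∕ `permuted_of_linear_rows` (rev 5, critic P2 ∕ l.6833 tick): it suffices that the action PERMUTES the row family (strata carried to strata, box rows to box rows) — individual rows need not be invariant. CONSEQUENCES: **`no_design_of_no_invariant_design`** — an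
LP-INFEASIBILITY word proved on orbit variables closes ALL multiplicity patterns on that support (LP words transfer; MILP words do not);
**`card_mul_avg_int` ∕ `orbit_card_mul_avg_int`** — for an INTEGER design the orbit masses `|O|·(avg m)_O` are integers; **`smul_avg_integral`**
(THE EXPONENT LAW) — `d • avg m` is an integer orbit-constant design for any common multiple `d` of the orbit sizes; **`lattice_exponent`** —
for a `G`-stable subspace `K` ((H1) kernel) and an invariant functional μ: `d · μ(Λ_cell) ⊆ μ(Λ_orb)`, i.e. the μ-lattice of cell-level
integer designs sits over the orbit-level one with quotient exponent dividing `d` (PRED-N8.1, pre-registered bus l.6684 against kit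
j332773 «CELL-LATTICE»: on all 11 supports of record `d(S) = lcm |O| = 96`, orbit sizes ∈ {1,4,6,12,16,24,48,96}; INTERIM l.6529 ratios
64∕32 = 2 (MINMU-C), 3456∕1152 = 3 (L16-M*), 512∕256 = 2 (B4-M72), ℤ∕2 (L14-UNION), 1 elsewhere — all divide 96);
**`orbitMass_relaxation`** ∕ **`shadow`** — an integer design passing convex `G`-stable gates leaves an orbit-constant rational SHADOW passing
them with integral orbit masses («orbital shrinking», Fischetti–Liberti–Salvagnin–Walsh, Discrete Appl. Math. 222 (2017) Thm 2.4, Cor. 2.2,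
2.6; core points: Herr–Rehn–Schürmann, Oper. Res. Lett. 41 (2013); Bödi–Herr–Joswig, Math. Program. 137 (2013)) — the ORBIT-MASS MILP
(integrality on `M_O = |O|·m_O ≥ |O|`, not on `m_O`) is the exact necessary condition that transfers.
§1c FLUCTUATION SPLITTING ∕ RIGID ORBITS ∕ FIBRE CRITERION (rev 3; reading of kit j333399 «FLOWLP-SPRIME-ORBITMASS», hsemireg-monad-1 bus
l.6803: orbit-mass MILP on S′ FEASIBLE, shadow of 4 882 + 4 copies, μ = −256 i, 9 orbits with non-`|O|`-divisible masses, N18 forced at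
`15/2` per cell at the P-floor): `x = avg x + fluct x` with `fluct x` of zero mass on every orbit and in every `G`-stable submodule
containing `x` (`avg_add_fluct`, `sum_fluct_eq_zero`, `fluct_mem`); **`fibre_iff`** — a shadow `s` lifts to an INTEGER design of `K` iff
`s ∈ K` and `K ∩ ker avg` contains an `ε` with `s + ε` integral (the cell-level FIBRE problem = a coset condition on the zero-mass clean
fluctuations, plus signs); **`Rigid`** (an orbit on which `K ∩ ker avg` vanishes) and **`rigid_orbit_integer`** ∕ `not_rigid_of_not_dvd` —
on a rigid orbit every clean integer design is orbit-constant and its mass is `|O|`-divisible, so a shadow with a fractional per-cell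
value on a rigid orbit lifts to NO design of ANY multiplicity pattern (spec (S‴) RIGID-ORBITS-S′: is orbit N18 rigid for the cell-level
(H1)_full kernel on S′? — hub linear algebra, h16-ilp ∕ monad-1 matrices).

§2 CLASS LEVEL (tree objects `CWord`, `ClassScreen`, `MCell.ch`, `MConfig.wch`, `permAvg`, `deltaAvg`, `g1Avg`). The tree already has the
`G₁`-averaging WLOG for «(A1), m ≥ 1, μ ≠ 0» (`Pad4TowerPermWindow`, `Pad4TowerDeltaWindow`; cited). NEW: `S₄` and Δ act TRIVIALLY on
screen-passing class functions (`apply_permW_of_classScreen`, `twistW_pow_mul_of_classScreen`), hence **`wch_g1Avg_of_classScreen`: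
`wch (g1Avg m) = 96 · wch m` AS A WHOLE TENSOR** for every integer weighted design passing (A1) on a `G₁`-closed support — CLASS-LEVEL
ORBIT-BLINDNESS: THEOREM LC's `(h, m₁, μ′)`, MSIGN (`m₁ ≤ −1`, ORDER R19.257 (3)), `|μ|`-minima, C5∕LF∕PO∕c₈ rows of a non-constant clean
design are those of an orbit-constant INTEGER design up to the scale 96 (sharp scale: `d(S)` of §1). §2b **`hull_orbitConstant_wlog`**
(with `g1Avg_pos_on_hull`): the same for a design on ANY support `C`, not `G₁`-closed, living on its `G₁`-HULL `satG1 C` — the averaged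
design is orbit-constant with FULL support on the hull, (A1), `μ ≠ 0`, class tensor `× 96`: the «`G₁`-closed support ∕ orbit-constant
multiplicity» proviso of every CLASS-LEVEL word of record can be dropped (read «support with `G₁`-hull S» for «`G₁`-closed support S»).
THE TYPED OBSTRUCTION (negation lens): the census's forced shape «carrier outside the `G₁`-closed ∕ orbit-constant world» is INVISIBLE to
every class-level and LP-level instrument; only SUPPORT-COMBINATORIAL structure (two-level SAT, `H₁`-static: X⁺∕A2I⁻ closure is not
hull-stable — LINES 1, 5–7) and INTEGRALITY below the exponent `d(S) ∣ 96` (orbit-mass MILP, CELL-LATTICE index) can see it.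

§3 SUPPORT LEVEL (tree, LEMMA P `Pad4TowerPermCovarianceStatic`): the `G₁`-hull `satG1 C` of a support keeps RULE D(μ₄), the diamond and
containment and is `G₁`-closed (`hull_keeps_ruleD_and_diamond`) — the support of the shadow; X⁺∕A2I⁻ are NOT monotone in the support (LEMMA P
header) and are NOT claimed.

SOURCES: bus l.6684 (this seat: SIGN-IN, PRED-N8.1), director-hodge g22 R19.257 l.6689 ((2) LF GATE, (3) MSIGN-LP, (4) rooms), CELL-LATTICE
PREREG v0 + kit j332773 INTERIM l.6529 (hsemireg-support-h16-ilp g0; `kit-celllattice/orbitlp.py` `orbit_cells`, inputs `*.orbits`),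
FLOWLP-S′-v2 RESULT memo a8ae24c5 (kit j332941, hsemireg-monad-1 g0), FLOWLP-orbitmass RESULT memo 94ec7b2c (kit j333399, monad-1, l.6803), CELL-LATTICE RESULT memo v3 07c34ee9 §4d (l.6757), director R19.258 (4) l.6710 ∕ R19.261 (2) l.6769, bc5-plan g12 THEOREM LC ∕ LF ∕ PO l.6651, director-hodge g21 FINAL
§ v4 (ladder-directors HANDOFF l.8765). Tree: `Pad4TowerClassScreen` (`CWord`, `EFree`, `wdeg`, `eWord`, `ebarWord`, `ClassScreen`),
`Pad4TowerPermWindow` (`permW`, `classScreen_permW`, `MCell.ch_perm`, `permAvg`, `MConfig.wch_permAvg`, `classScreen_permAvg`, `g1Avg`),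
`Pad4TowerDeltaWindow` (`twistW`, `MConfig.wch_comp_delta∕2∕3`, `wch_deltaAvg`), `Pad4TowerPhaseTorus` (`twistT_eWord_eq_one_iff`),
`Pad4TowerPermCovarianceStatic` (`satG1`, `ruleDMu4Closed_satG1`, `inDiamond_satG1`, `g1Closed_satG1`, `sub_satG1`). -/

set_option linter.dupNamespace false

namespace Summit.HodgeConjecture.HodgeConjecture.Cruxes.BlochSeedDiscOne.OrbitMassShadow

open Finset

/-! ## §1 The abstract Reynolds law: a finite group acting on a finite index set, designs `ι → ℚ` -/

section Reynolds

variable (G : Type*) {ι : Type*} [Group G] [MulAction G ι]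

/-- the translate of a design by a group element: `(tr g f) i = f (g • i)`. -/
def tr (g : G) (f : ι → ℚ) : ι → ℚ := fun i => f (g • i)

variable {G} in
theorem tr_apply (g : G) (f : ι → ℚ) (i : ι) : tr G g f i = f (g • i) := rfl

/-- a `G`-stable finset of indices (a union of orbits, e.g. one orbit, or a `G`-closed support). -/
abbrev GStable (O : Finset ι) : Prop := ∀ g : G, ∀ i ∈ O, g • i ∈ O

variable {G} in
theorem GStable.smul_mem_iff {O : Finset ι} (hO : GStable (G := G) O) (g : G) {i : ι} : g • i ∈ O ↔ i ∈ O := by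
  refine ⟨fun h => ?_, hO g i⟩
  have := hO g⁻¹ _ h
  simpa using this

variable {G} in
/-- a translate has the same mass on a `G`-stable finset: `Σ_{i ∈ O} f (g • i) = Σ_{i ∈ O} f i`. -/
theorem sum_tr_eq_sum {O : Finset ι} (hO : GStable (G := G) O) (f : ι → ℚ) (g : G) :
    ∑ i ∈ O, f (g • i) = ∑ i ∈ O, f i := by
  refine Finset.sum_nbij' (fun i => g • i) (fun i => g⁻¹ • i) (fun i hi => hO g i hi) (fun i hi => hO g⁻¹ i hi)
    (fun i _ => by simp) (fun i _ => by simp) (fun i _ => rfl)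

variable {G} in
/-- a linear row family `ℓ k f ≤ b k` closed under the action (`ℓ k ∘ tr g = ℓ (π g k)`, `b (π g k) = b k`) is PERMUTED by the action in the sense of `avg_mem_iInter_of_permuted` below. -/
theorem permuted_of_linear_rows {κ : Type*} (ℓ : κ → ((ι → ℚ) →ₗ[ℚ] ℚ)) (b : κ → ℚ) (π : G → κ → κ)
    (hℓ : ∀ g k f, ℓ k (tr G g f) = ℓ (π g k) f) (hb : ∀ g k, b (π g k) = b k) :
    ∀ g : G, ∀ k, ∃ k', ∀ f, f ∈ {f : ι → ℚ | ℓ k' f ≤ b k'} → tr G g f ∈ {f : ι → ℚ | ℓ k f ≤ b k} := by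
  intro g k
  refine ⟨π g k, fun f hf => ?_⟩
  simp only [Set.mem_setOf_eq] at hf ⊢
  rw [hℓ, ← hb g k]
  exact hf

variable [Fintype G]

/-- the REYNOLDS AVERAGE of a design over the group: `(avg G f) i = |G|⁻¹ · Σ_g f (g • i)`. -/
def avg (f : ι → ℚ) : ι → ℚ := fun i => (Fintype.card G : ℚ)⁻¹ * ∑ g : G, f (g • i)

variable {G}

theorem avg_apply (f : ι → ℚ) (i : ι) : avg G f i = (Fintype.card G : ℚ)⁻¹ * ∑ g : G, f (g • i) := rfl

theorem card_pos_rat : (0 : ℚ) < Fintype.card G := by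
  exact_mod_cast Fintype.card_pos

theorem card_ne_zero_rat : (Fintype.card G : ℚ) ≠ 0 := ne_of_gt card_pos_rat

/-- re-indexing the orbit sum by right multiplication: `Σ_g f (g • h • i) = Σ_g f (g • i)`. -/
theorem sum_smul_smul (f : ι → ℚ) (h : G) (i : ι) : ∑ g : G, f (g • h • i) = ∑ g : G, f (g • i) := by
  refine Fintype.sum_equiv (Equiv.mulRight h) _ _ (fun g => ?_)
  simp [mul_smul]

/-- re-indexing by left multiplication: `Σ_g f (h • g • i) = Σ_g f (g • i)`. -/
theorem sum_smul_smul' (f : ι → ℚ) (h : G) (i : ι) : ∑ g : G, f (h • g • i) = ∑ g : G, f (g • i) := by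
  refine Fintype.sum_equiv (Equiv.mulLeft h) _ _ (fun g => ?_)
  simp [mul_smul]

/-- **the average is `G`-INVARIANT (orbit-constant):** `avg f (h • i) = avg f i`. -/
theorem avg_smul (f : ι → ℚ) (h : G) (i : ι) : avg G f (h • i) = avg G f i := by
  simp only [avg_apply, sum_smul_smul]

/-- … equivalently `tr h (avg f) = avg f`. -/
theorem tr_avg (f : ι → ℚ) (h : G) : tr G h (avg G f) = avg G f := by
  funext i; exact avg_smul f h i

/-- the average of a translate is the average. -/
theorem avg_tr (f : ι → ℚ) (h : G) : avg G (tr G h f) = avg G f := by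
  funext i; simp only [avg_apply, tr_apply, sum_smul_smul']

/-- an invariant design is its own average. -/
theorem avg_eq_self_of_invariant (f : ι → ℚ) (hf : ∀ g : G, ∀ i, f (g • i) = f i) : avg G f = f := by
  funext i
  simp only [avg_apply, hf, sum_const, card_univ, nsmul_eq_mul]
  field_simp [card_ne_zero_rat]

/-- the average is idempotent. -/
theorem avg_avg (f : ι → ℚ) : avg G (avg G f) = avg G f :=
  avg_eq_self_of_invariant _ (fun g i => avg_smul f g i)

/-- the average, written as the uniform convex combination of the translates. -/
theorem avg_eq_sum_smul_tr (f : ι → ℚ) :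
    avg G f = ∑ g : G, (Fintype.card G : ℚ)⁻¹ • tr G g f := by
  funext i
  simp only [avg_apply, Finset.sum_apply, Pi.smul_apply, tr_apply, smul_eq_mul, Finset.mul_sum]

/-- **convex `G`-stable gates are passed by the average:** if `K` is convex, stable under every translate, and `f ∈ K`, then `avg f ∈ K`
(every LP-level gate of the census: class screen, rank row, `m ≥ 1`, zero-deficit flow feasibility on a `G`-stable strata family). -/
theorem avg_mem_of_convex (K : Set (ι → ℚ)) (hK : Convex ℚ K) (hGK : ∀ g : G, ∀ f ∈ K, tr G g f ∈ K)
    {f : ι → ℚ} (hf : f ∈ K) : avg G f ∈ K := by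
  rw [avg_eq_sum_smul_tr]
  refine hK.sum_mem (fun g _ => ?_) ?_ (fun g _ => hGK g f hf)
  · positivity
  · simp only [sum_const, card_univ, nsmul_eq_mul]
    field_simp [card_ne_zero_rat]

/-- an intersection of gates: if `f` passes every gate of a family of convex `G`-stable gates, so does its average. -/
theorem avg_mem_iInter_of_convex {κ : Type*} (K : κ → Set (ι → ℚ)) (hK : ∀ k, Convex ℚ (K k))
    (hGK : ∀ k, ∀ g : G, ∀ f ∈ K k, tr G g f ∈ K k) {f : ι → ℚ} (hf : ∀ k, f ∈ K k) : ∀ k, avg G f ∈ K k :=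
  fun k => avg_mem_of_convex (K k) (hK k) (hGK k) (hf k)

/-- **invariant linear functionals are preserved** (μ = `E_eeee`, the rank row, m₁, every (H1) coordinate): `ℓ (avg f) = ℓ f`. -/
theorem apply_avg_of_invariant (ℓ : (ι → ℚ) →ₗ[ℚ] ℚ) (hℓ : ∀ g : G, ∀ f, ℓ (tr G g f) = ℓ f) (f : ι → ℚ) :
    ℓ (avg G f) = ℓ f := by
  rw [avg_eq_sum_smul_tr, map_sum]
  simp only [map_smul, hℓ, smul_eq_mul, sum_const, card_univ, nsmul_eq_mul]
  field_simp [card_ne_zero_rat]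

/-- **semi-invariant functionals die on the average:** if some `g` rescales `ℓ` by `c ≠ 1` (`ℓ (tr g f) = c · ℓ f` for all `f` — the
full factorwise torus multiplies μ by `Π ζ_f`), then `ℓ (avg f) = 0`: averaging over a group that moves μ's phase forces μ = 0. -/
theorem apply_avg_eq_zero_of_semi (ℓ : (ι → ℚ) →ₗ[ℚ] ℚ) {g : G} {c : ℚ} (hc : c ≠ 1)
    (hℓ : ∀ f, ℓ (tr G g f) = c * ℓ f) (f : ι → ℚ) : ℓ (avg G f) = 0 := by
  have h := hℓ (avg G f)
  rw [tr_avg] at h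
  have h' : (c - 1) * ℓ (avg G f) = 0 := by rw [sub_mul, one_mul, ← h, sub_self]
  rcases mul_eq_zero.mp h' with h1 | h1
  · exact absurd (sub_eq_zero.mp h1) hc
  · exact h1

/-- **ORBIT MASSES ARE PRESERVED:** on every `G`-stable finset the average has the same total mass as the design. -/
theorem sum_avg_eq_sum {O : Finset ι} (hO : GStable (G := G) O) (f : ι → ℚ) :
    ∑ i ∈ O, avg G f i = ∑ i ∈ O, f i := by
  simp only [avg_apply]
  rw [← Finset.mul_sum, Finset.sum_comm]
  simp only [sum_tr_eq_sum hO, sum_const, card_univ, nsmul_eq_mul]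
  field_simp [card_ne_zero_rat]

/-- on a `G`-stable finset lying in ONE orbit the average is constant, so `|O| · (avg f) i = Σ_{j ∈ O} f j`. -/
theorem card_mul_avg_eq_sum {O : Finset ι} (hO : GStable (G := G) O) {i : ι}
    (horb : ∀ j ∈ O, ∃ g : G, g • i = j) (f : ι → ℚ) :
    (O.card : ℚ) * avg G f i = ∑ j ∈ O, f j := by
  rw [← sum_avg_eq_sum hO f]
  have : ∀ j ∈ O, avg G f j = avg G f i := by
    intro j hj
    obtain ⟨g, rfl⟩ := horb j hj
    exact avg_smul f g i
  rw [Finset.sum_congr rfl this, sum_const, nsmul_eq_mul]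

/-- **ORBIT-MASS INTEGRALITY:** for an INTEGER design, `|O| · (avg f) i` is an integer on every orbit piece `O ∋ i`
(orbit-breaking pays only in denominators dividing the orbit sizes, hence dividing `lcm |O| ∣ |G|`). -/
theorem card_mul_avg_int {O : Finset ι} (hO : GStable (G := G) O) {i : ι}
    (horb : ∀ j ∈ O, ∃ g : G, g • i = j) (x : ι → ℤ) :
    (O.card : ℚ) * avg G (fun j => (x j : ℚ)) i = ((∑ j ∈ O, x j : ℤ) : ℚ) := by
  rw [card_mul_avg_eq_sum hO horb]
  push_cast
  rfl

/-- the coarse form with the group order: `|G| · (avg f) i = Σ_g f (g • i)` is an integer for an integer design. -/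
theorem cardG_mul_avg_int (x : ι → ℤ) (i : ι) :
    (Fintype.card G : ℚ) * avg G (fun j => (x j : ℚ)) i = ((∑ g : G, x (g • i) : ℤ) : ℚ) := by
  rw [avg_apply, ← mul_assoc, mul_inv_cancel₀ card_ne_zero_rat, one_mul]
  push_cast
  rfl

/-- **LP-EMPTINESS TRANSFERS:** if NO `G`-invariant (orbit-constant) design passes a family of convex `G`-stable gates, then no design
of any multiplicity pattern does (an LP-infeasibility word on orbit variables closes the whole «non-constant room» on that support). -/
theorem no_design_of_no_invariant_design {κ : Type*} (K : κ → Set (ι → ℚ)) (hK : ∀ k, Convex ℚ (K k))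
    (hGK : ∀ k, ∀ g : G, ∀ f ∈ K k, tr G g f ∈ K k)
    (hnone : ∀ f : ι → ℚ, (∀ g : G, ∀ i, f (g • i) = f i) → ¬ ∀ k, f ∈ K k) (f : ι → ℚ) : ¬ ∀ k, f ∈ K k :=
  fun hf => hnone (avg G f) (fun g i => avg_smul f g i) (avg_mem_iInter_of_convex K hK hGK hf)

/-- **FAMILY FORM (critic P2 ∕ l.6833 tick «strata family G-stable»):** if the action PERMUTES a family of convex gates — for every `g`
and every row `k` there is a row `k'` with `tr g (K k') ⊆ K k` (individual strata ∕ rows need NOT be invariant, only the family) — then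
the average of a design passing ALL rows passes all rows.  For linear rows `ℓ_k f ≤ b_k` this is: `ℓ_k ∘ tr g = ℓ_{k'}` and `b_k = b_{k'}`. -/
theorem avg_mem_iInter_of_permuted {κ : Type*} (K : κ → Set (ι → ℚ)) (hK : ∀ k, Convex ℚ (K k))
    (hperm : ∀ g : G, ∀ k, ∃ k', ∀ f, f ∈ K k' → tr G g f ∈ K k) {f : ι → ℚ} (hf : ∀ k, f ∈ K k) :
    ∀ k, avg G f ∈ K k := by
  have hS : avg G f ∈ ⋂ k, K k := by
    refine avg_mem_of_convex (⋂ k, K k) (convex_iInter hK) ?_ (Set.mem_iInter.mpr hf)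
    intro g h hh
    refine Set.mem_iInter.mpr fun k => ?_
    obtain ⟨k', hk'⟩ := hperm g k
    exact hk' h (Set.mem_iInter.mp hh k')
  exact fun k => Set.mem_iInter.mp hS k

/-- family form of the transfer: LP-emptiness proved on `G`-invariant designs for a PERMUTED row family closes all designs. -/
theorem no_design_of_no_invariant_design' {κ : Type*} (K : κ → Set (ι → ℚ)) (hK : ∀ k, Convex ℚ (K k))
    (hperm : ∀ g : G, ∀ k, ∃ k', ∀ f, f ∈ K k' → tr G g f ∈ K k)
    (hnone : ∀ f : ι → ℚ, (∀ g : G, ∀ i, f (g • i) = f i) → ¬ ∀ k, f ∈ K k) (f : ι → ℚ) : ¬ ∀ k, f ∈ K k :=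
  fun hf => hnone (avg G f) (fun g i => avg_smul f g i) (avg_mem_iInter_of_permuted K hK hperm hf)


variable (G) in
/-- the orbit of an index as a finset: `{g • i : g ∈ G}`. -/
def orbitFs [DecidableEq ι] (i : ι) : Finset ι := Finset.univ.image fun g : G => g • i

theorem mem_orbitFs_self [DecidableEq ι] (i : ι) : i ∈ orbitFs G i :=
  Finset.mem_image.mpr ⟨1, Finset.mem_univ _, one_smul G i⟩

theorem mem_orbitFs_iff [DecidableEq ι] {i j : ι} : j ∈ orbitFs G i ↔ ∃ g : G, g • i = j := by
  simp only [orbitFs, Finset.mem_image, Finset.mem_univ, true_and]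

theorem gStable_orbitFs [DecidableEq ι] (i : ι) : GStable (G := G) (orbitFs G i) := by
  intro g j hj
  obtain ⟨h, rfl⟩ := (mem_orbitFs_iff (G := G)).mp hj
  exact (mem_orbitFs_iff (G := G)).mpr ⟨g * h, mul_smul g h i⟩

/-- **per-orbit integrality:** `|G • i| · (avg x) i ∈ ℤ` for an integer design `x`. -/
theorem orbit_card_mul_avg_int [DecidableEq ι] (x : ι → ℤ) (i : ι) :
    ((orbitFs G i).card : ℚ) * avg G (fun j => (x j : ℚ)) i = ((∑ j ∈ orbitFs G i, x j : ℤ) : ℚ) :=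
  card_mul_avg_int (gStable_orbitFs i) (fun _ hj => (mem_orbitFs_iff (G := G)).mp hj) x

/-- **THE EXPONENT LAW (kernel form of PRED-N8.1):** if `d` is a common multiple of the orbit sizes, then `d • avg x` is an INTEGER
orbit-constant design for every integer design `x` — orbit-breaking pays only in denominators dividing `d = lcm |O|` (`∣ |G| = 96` in the census). -/
theorem smul_avg_integral [DecidableEq ι] {d : ℕ} (hd : ∀ i : ι, (orbitFs G i).card ∣ d) (x : ι → ℤ) :
    ∃ y : ι → ℤ, (∀ i, (y i : ℚ) = (d : ℚ) * avg G (fun j => (x j : ℚ)) i) ∧ ∀ g : G, ∀ i, y (g • i) = y i := by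
  classical
  have key : ∀ i, ∃ z : ℤ, (z : ℚ) = (d : ℚ) * avg G (fun j => (x j : ℚ)) i := by
    intro i
    obtain ⟨e, he⟩ := hd i
    refine ⟨(e : ℤ) * ∑ j ∈ orbitFs G i, x j, ?_⟩
    have hc : ((orbitFs G i).card : ℚ) * avg G (fun j => (x j : ℚ)) i = ((∑ j ∈ orbitFs G i, x j : ℤ) : ℚ) :=
      orbit_card_mul_avg_int x i
    rw [he]; push_cast; rw [mul_comm ((orbitFs G i).card : ℚ), mul_assoc, hc]; push_cast; ring
  choose y hy using key
  refine ⟨y, hy, fun g i => ?_⟩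
  have : (y (g • i) : ℚ) = y i := by rw [hy, hy, avg_smul]
  exact_mod_cast this

/-- **THE LATTICE COROLLARY `d · Λ_cell ⊆ Λ_orb`:** for a `G`-stable ℚ-subspace `K` (the kernel of the class screen (H1)_full) and a
`G`-invariant functional `μ` (the Weil coordinate), every INTEGER kernel vector `x` has an INTEGER ORBIT-CONSTANT kernel vector `y` with
`μ y = d · μ x`, `d` any common multiple of the orbit sizes: the quotient `Λ_cell ∕ Λ_orb` of the μ-lattices has exponent dividing `d`. -/
theorem lattice_exponent [DecidableEq ι] (K : Submodule ℚ (ι → ℚ)) (hGK : ∀ g : G, ∀ f ∈ K, tr G g f ∈ K)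
    (μ : (ι → ℚ) →ₗ[ℚ] ℚ) (hμ : ∀ g : G, ∀ f, μ (tr G g f) = μ f) {d : ℕ} (hd : ∀ i : ι, (orbitFs G i).card ∣ d)
    (x : ι → ℤ) (hx : (fun j => (x j : ℚ)) ∈ K) :
    ∃ y : ι → ℤ, (fun j => (y j : ℚ)) ∈ K ∧ (∀ g : G, ∀ i, y (g • i) = y i) ∧
      μ (fun j => (y j : ℚ)) = (d : ℚ) * μ (fun j => (x j : ℚ)) := by
  obtain ⟨y, hy, hyinv⟩ := smul_avg_integral (G := G) hd x
  have hyeq : (fun j => (y j : ℚ)) = (d : ℚ) • avg G (fun j => (x j : ℚ)) := by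
    funext j; rw [hy]; rfl
  refine ⟨y, ?_, hyinv, ?_⟩
  · rw [hyeq]
    exact K.smul_mem _ (avg_mem_of_convex (K : Set (ι → ℚ)) K.convex hGK hx)
  · rw [hyeq, map_smul, apply_avg_of_invariant μ hμ, smul_eq_mul]

/-- **THE ORBIT-MASS RELAXATION:** if an INTEGER design passes a family of convex `G`-stable gates, then a `G`-invariant rational design
passes them whose mass on every orbit is an integer (the ORBIT-MASS MILP of the card: integrality on `|O|·m_O`, not on `m_O`). -/
theorem orbitMass_relaxation [DecidableEq ι] {κ : Type*} (K : κ → Set (ι → ℚ)) (hK : ∀ k, Convex ℚ (K k))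
    (hGK : ∀ k, ∀ g : G, ∀ f ∈ K k, tr G g f ∈ K k) (x : ι → ℤ) (hx : ∀ k, (fun j => (x j : ℚ)) ∈ K k) :
    ∃ f : ι → ℚ, (∀ k, f ∈ K k) ∧ (∀ g : G, ∀ i, f (g • i) = f i) ∧
      ∀ i, ∃ z : ℤ, ((orbitFs G i).card : ℚ) * f i = z :=
  ⟨avg G (fun j => (x j : ℚ)), avg_mem_iInter_of_convex K hK hGK hx, fun g i => avg_smul _ g i,
    fun i => ⟨∑ j ∈ orbitFs G i, x j, orbit_card_mul_avg_int x i⟩⟩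

/-- **THE SHADOW THEOREM (orbital-shrinking relaxation, census form).** If an integer design `x` passes a family of convex `G`-stable
gates, then its Reynolds average is a `G`-INVARIANT rational design passing the same gates, with the same value on every `G`-invariant
linear functional, and with INTEGRAL orbit masses on every `G`-stable finset. -/
theorem shadow {κ : Type*} (K : κ → Set (ι → ℚ)) (hK : ∀ k, Convex ℚ (K k))
    (hGK : ∀ k, ∀ g : G, ∀ f ∈ K k, tr G g f ∈ K k) (x : ι → ℤ) (hx : ∀ k, (fun j => (x j : ℚ)) ∈ K k) :
    (∀ k, avg G (fun j => (x j : ℚ)) ∈ K k) ∧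
      (∀ g : G, ∀ i, avg G (fun j => (x j : ℚ)) (g • i) = avg G (fun j => (x j : ℚ)) i) ∧
      (∀ ℓ : (ι → ℚ) →ₗ[ℚ] ℚ, (∀ g : G, ∀ f, ℓ (tr G g f) = ℓ f) →
        ℓ (avg G (fun j => (x j : ℚ))) = ℓ (fun j => (x j : ℚ))) ∧
      (∀ O : Finset ι, GStable (G := G) O → ∃ z : ℤ, ∑ i ∈ O, avg G (fun j => (x j : ℚ)) i = z) :=
  ⟨avg_mem_iInter_of_convex K hK hGK hx, fun g i => avg_smul _ g i,
    fun ℓ hℓ => apply_avg_of_invariant ℓ hℓ _,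
    fun O hO => ⟨∑ i ∈ O, x i, by rw [sum_avg_eq_sum hO]; push_cast; rfl⟩⟩

/-! ### §1c FLUCTUATION SPLITTING and RIGID ORBITS — the cell-level FIBRE over an orbit-level shadow
(reading of hsemireg-monad-1 kit j333399 «FLOWLP-SPRIME-ORBITMASS», bus l.6803: the orbit-mass MILP on S′ is FEASIBLE, 9 orbits of the
shadow carry non-`|O|`-divisible masses, e.g. N18 at `15/2` per cell).  Every design splits UNIQUELY as `x = avg x + fluct x`: the
shadow (orbit-constant) plus a FLUCTUATION with zero mass on every orbit; if `x` lies in a `G`-stable submodule `K` (the clean designs on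
a support) so do both parts.  Hence the fibre over a shadow `s` is exactly the set of `ε ∈ K` with `avg ε = 0` and `s + ε` integral
(`fibre_iff`), and an orbit on which `K` carries NO zero-mass fluctuation (`Rigid`) forces every clean integer design to be
orbit-constant there, so its mass is `|O|`-divisible (`rigid_orbit_integer`): a shadow with a fractional per-cell value on a rigid orbit
NEVER lifts, for any multiplicity pattern. -/

theorem avg_add (f h : ι → ℚ) : avg G (f + h) = avg G f + avg G h := by
  funext i; simp only [avg_apply, Pi.add_apply, Finset.sum_add_distrib, mul_add]

theorem avg_sub (f h : ι → ℚ) : avg G (f - h) = avg G f - avg G h := by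
  funext i; simp only [avg_apply, Pi.sub_apply, Finset.sum_sub_distrib, mul_sub]

variable (G) in
/-- the FLUCTUATION of a design: `f - avg f`. -/
def fluct (f : ι → ℚ) : ι → ℚ := f - avg G f

theorem fluct_apply (f : ι → ℚ) (i : ι) : fluct G f i = f i - avg G f i := rfl

/-- **splitting:** `avg f + fluct f = f`. -/
theorem avg_add_fluct (f : ι → ℚ) : avg G f + fluct G f = f := by
  funext i; simp only [Pi.add_apply, fluct_apply, add_sub_cancel]

/-- the fluctuation has zero average … -/
theorem avg_fluct (f : ι → ℚ) : avg G (fluct G f) = 0 := by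
  show avg G (f - avg G f) = 0
  rw [avg_sub, avg_avg, sub_self]

/-- … i.e. zero mass on every `G`-stable finset (every orbit). -/
theorem sum_fluct_eq_zero {O : Finset ι} (hO : GStable (G := G) O) (f : ι → ℚ) : ∑ i ∈ O, fluct G f i = 0 := by
  simp only [fluct_apply, Finset.sum_sub_distrib, sum_avg_eq_sum hO, sub_self]

/-- the fluctuation of a design in a `G`-stable submodule (e.g. the (H1)-clean designs on a `G`-closed support) stays in it. -/
theorem fluct_mem (K : Submodule ℚ (ι → ℚ)) (hGK : ∀ g : G, ∀ f ∈ K, tr G g f ∈ K) {f : ι → ℚ} (hf : f ∈ K) :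
    fluct G f ∈ K :=
  K.sub_mem hf (avg_mem_of_convex (K : Set (ι → ℚ)) K.convex hGK hf)

theorem orbitFs_card_pos [DecidableEq ι] (i : ι) : 0 < (orbitFs G i).card :=
  Finset.card_pos.mpr ⟨i, mem_orbitFs_self i⟩

/-- zero average ⇔ zero mass on every orbit. -/
theorem avg_eq_zero_iff_zeroMass [DecidableEq ι] (f : ι → ℚ) :
    avg G f = 0 ↔ ∀ i, ∑ j ∈ orbitFs G i, f j = 0 := by
  have hsum : ∀ i, ((orbitFs G i).card : ℚ) * avg G f i = ∑ j ∈ orbitFs G i, f j := fun i =>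
    card_mul_avg_eq_sum (gStable_orbitFs i) (fun _ hj => (mem_orbitFs_iff (G := G)).mp hj) f
  constructor
  · intro h i
    rw [← hsum i, h, Pi.zero_apply, mul_zero]
  · intro h
    funext i
    have hc : ((orbitFs G i).card : ℚ) ≠ 0 := by exact_mod_cast (orbitFs_card_pos (G := G) i).ne'
    have hi := hsum i
    rw [h i] at hi
    exact (mul_eq_zero.mp hi).resolve_left hc

variable (G) in
/-- the orbit `G • i` is **RIGID** for the submodule `K` (of clean designs on a support): `K` carries no zero-mass fluctuation on it —
every `y ∈ K` with `avg y = 0` vanishes on the whole orbit.  (Decidable by linear algebra: the restriction to the orbit of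
`K ∩ ker avg` is `0`; for the census, `K` = kernel of the CELL-level (H1)_full rows on the support.) -/
def Rigid [DecidableEq ι] (K : Submodule ℚ (ι → ℚ)) (i : ι) : Prop :=
  ∀ y ∈ K, avg G y = 0 → ∀ j ∈ orbitFs G i, y j = 0

/-- **on a rigid orbit every design of `K` is orbit-constant.** -/
theorem constant_on_rigid_orbit [DecidableEq ι] (K : Submodule ℚ (ι → ℚ)) (hGK : ∀ g : G, ∀ f ∈ K, tr G g f ∈ K)
    {i : ι} (hR : Rigid G K i) {f : ι → ℚ} (hf : f ∈ K) : ∀ j ∈ orbitFs G i, f j = f i := by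
  have key : ∀ j ∈ orbitFs G i, f j = avg G f i := by
    intro j hj
    have h0 := hR (fluct G f) (fluct_mem K hGK hf) (avg_fluct f) j hj
    obtain ⟨g, rfl⟩ := (mem_orbitFs_iff (G := G)).mp hj
    rw [fluct_apply, sub_eq_zero, avg_smul] at h0
    exact h0
  intro j hj
  rw [key j hj, key i (mem_orbitFs_self i)]

/-- **RIGID-ORBIT MASS LAW:** a clean INTEGER design is constant on every rigid orbit, so its mass there is a multiple of `|O|` —
a shadow whose per-cell value on a rigid orbit is fractional (monad-1's N18 at `15/2`, IF orbit 18 is rigid in S′) lifts to NO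
integer design of ANY multiplicity pattern. -/
theorem rigid_orbit_integer [DecidableEq ι] (K : Submodule ℚ (ι → ℚ)) (hGK : ∀ g : G, ∀ f ∈ K, tr G g f ∈ K)
    {i : ι} (hR : Rigid G K i) (x : ι → ℤ) (hx : (fun j => (x j : ℚ)) ∈ K) :
    (∀ j ∈ orbitFs G i, x j = x i) ∧ ((orbitFs G i).card : ℤ) ∣ ∑ j ∈ orbitFs G i, x j := by
  have hc : ∀ j ∈ orbitFs G i, x j = x i := fun j hj => by
    have h : (x j : ℚ) = (x i : ℚ) := constant_on_rigid_orbit K hGK hR hx j hj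
    exact_mod_cast h
  refine ⟨hc, ⟨x i, ?_⟩⟩
  rw [Finset.sum_congr rfl hc, Finset.sum_const, nsmul_eq_mul]

/-- contrapositive, the census's detector of orbit-breaking: a clean integer design with a NON-`|O|`-divisible mass on an orbit
exhibits a zero-mass clean fluctuation living on that orbit (the orbit is not rigid). -/
theorem not_rigid_of_not_dvd [DecidableEq ι] (K : Submodule ℚ (ι → ℚ)) (hGK : ∀ g : G, ∀ f ∈ K, tr G g f ∈ K)
    {i : ι} (x : ι → ℤ) (hx : (fun j => (x j : ℚ)) ∈ K) (h : ¬ ((orbitFs G i).card : ℤ) ∣ ∑ j ∈ orbitFs G i, x j) :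
    ¬ Rigid G K i :=
  fun hR => h (rigid_orbit_integer K hGK hR x hx).2

/-- **THE FIBRE CRITERION:** an orbit-constant shadow `s` is the average of some INTEGER design of `K` iff `s ∈ K` and `K` contains a
zero-average fluctuation `ε` making `s + ε` integral.  (The cell-level FIBRE MILP of the census = the search for `ε` in
`K ∩ ker avg` with prescribed fractional parts `-s` per orbit, plus the sign condition `s + ε ≥ 1`.) -/
theorem fibre_iff (K : Submodule ℚ (ι → ℚ)) (hGK : ∀ g : G, ∀ f ∈ K, tr G g f ∈ K) (s : ι → ℚ)
    (hs : ∀ g : G, ∀ i, s (g • i) = s i) :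
    (∃ x : ι → ℤ, (fun j => (x j : ℚ)) ∈ K ∧ avg G (fun j => (x j : ℚ)) = s) ↔
      (s ∈ K ∧ ∃ ε ∈ K, avg G ε = 0 ∧ ∀ i, ∃ z : ℤ, s i + ε i = z) := by
  constructor
  · rintro ⟨x, hxK, rfl⟩
    refine ⟨avg_mem_of_convex (K : Set (ι → ℚ)) K.convex hGK hxK, fluct G (fun j => (x j : ℚ)), fluct_mem K hGK hxK,
      avg_fluct _, fun i => ⟨x i, ?_⟩⟩
    have h := congrFun (avg_add_fluct (G := G) (fun j => (x j : ℚ))) i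
    simpa only [Pi.add_apply] using h
  · rintro ⟨hsK, ε, hεK, hε0, hint⟩
    choose z hz using hint
    have hz' : (fun j => (z j : ℚ)) = s + ε := by
      funext j; rw [← hz j]; rfl
    refine ⟨z, ?_, ?_⟩
    · rw [hz']; exact K.add_mem hsK hεK
    · rw [hz', avg_add, hε0, add_zero, avg_eq_self_of_invariant s hs]

end Reynolds

/-! ## §2 The class-level instance over the tree's class frame (`Pad4TowerClassScreen`): `S₄`-covariance of the screen, invariance of μ,
and the triviality of the diagonal phase Δ on screen-passing class functions -/

section ClassLevel

open Summit.Ventures.HSemireg.Pad4Tower Summit.Ventures.HSemireg.Pad4FirstOrder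

/-! The tree ALREADY has (cited, not restated): the `S₄` word action `permW` and `classScreen_permW`, `MCell.ch_perm` (a permuted cell permutes
the WORD), the Δ-twist `MCell.ch_delta` ∕ `twistW` and `classScreen_twist`, and the `G₁ = ⟨Δ⟩ × S₄` AVERAGING WLOG for «(A1), m ≥ 1, μ ≠ 0»
(`MConfig.permInvariant_wlog`, `MConfig.deltaInvariant_wlog`, `MConfig.g1Invariant_wlog`, `MConfig.wch_g1Avg_eWord`: μ × 96) —
`Pad4TowerPermWindow` ∕ `Pad4TowerDeltaWindow`. NEW HERE: `G₁` acts TRIVIALLY on screen-passing class functions, hence `G₁`-averaging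
preserves the ENTIRE class tensor (× 96), not only the screen and the μ-word. -/

/-- **`S₄` ACTS TRIVIALLY ON SCREEN-PASSING CLASS FUNCTIONS:** `T (σ·w) = T w` for every word (e-free words of equal degree agree; `eeee`,
`ēēēē` are fixed words; every other e-mixed word and its permutation both vanish). Strictly stronger than `classScreen_permW` (stability). -/
theorem apply_permW_of_classScreen {R : Type*} [Zero R] (σ : Equiv.Perm (Fin 4)) {T : CWord → R} (hT : ClassScreen T)
    (w : CWord) : T (permW σ w) = T w := by
  by_cases hw : EFree w
  · exact hT.2 _ _ ((eFree_permW_iff σ w).mpr hw) hw (wdeg_permW σ w)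
  · by_cases hwe : w = eWord
    · subst hwe; rw [permW_eWord]
    · by_cases hwb : w = ebarWord
      · subst hwb; rw [permW_ebarWord]
      · rw [hT.1 w hw hwe hwb]
        refine hT.1 _ (fun h => hw ((eFree_permW_iff σ w).mp h)) (fun h => hwe ?_) (fun h => hwb ?_)
        · have h' := congrArg (permW σ⁻¹) h
          rwa [permW_inv_permW, permW_eWord] at h'
        · have h' := congrArg (permW σ⁻¹) h
          rwa [permW_inv_permW, permW_ebarWord] at h'

/-- **Δ ACTS TRIVIALLY ON SCREEN-PASSING CLASS FUNCTIONS** (over `ℤ[i]`): `i^{k(n_e − n_ē)} · T w = T w` for every word (`χ(Δ) = i⁴ = 1`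
on `eeee`, e-free words untwisted, the rest vanish) — Δ-orbit-breaking is invisible to EVERY class row, not only to μ. -/
theorem twistW_pow_mul_of_classScreen {T : CWord → GaussianInt} (hT : ClassScreen T) (k : ℕ) (w : CWord) :
    twistW w ^ k * T w = T w := by
  by_cases hw : EFree w
  · rw [twistW_eq_one_of_eFree w hw, one_pow, one_mul]
  · by_cases hwe : w = eWord
    · subst hwe; rw [twistW_eWord.1, one_pow, one_mul]
    · by_cases hwb : w = ebarWord
      · subst hwb; rw [twistW_eWord.2, one_pow, one_mul]
      · rw [hT.1 w hw hwe hwb, mul_zero]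

/-- **EXACT CLASS PRESERVATION UNDER `S₄`-AVERAGING:** on an `S₄`-closed support, if the weighted class tensor of `(mN, mP)` passes (A1)
then the `S₄`-averaged design has class tensor EXACTLY `24 ×` the original — as a whole tensor (tree: `wch_permAvg_eWord` for the μ-word). -/
theorem wch_permAvg_of_classScreen (C : MConfig) (hl : PermClosed C.lower) (hu : PermClosed C.upper) (mN mP : MCell → ℤ)
    (h : ClassScreen (C.wch mN mP)) (w : CWord) : C.wch (permAvg mN) (permAvg mP) w = 24 * C.wch mN mP w := by
  rw [C.wch_permAvg hl hu]
  simp only [apply_permW_of_classScreen _ h, Finset.sum_const, Finset.card_univ, Fintype.card_perm, Fintype.card_fin,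
    nsmul_eq_mul]
  norm_num [Nat.factorial]

/-- **EXACT CLASS PRESERVATION UNDER Δ-AVERAGING:** `wch (deltaAvg m) = 4 · wch m` as a whole tensor, given (A1). -/
theorem wch_deltaAvg_of_classScreen (C : MConfig) (hl : DeltaClosed C.lower) (hu : DeltaClosed C.upper) (mN mP : MCell → ℤ)
    (h : ClassScreen (C.wch mN mP)) (w : CWord) : C.wch (deltaAvg mN) (deltaAvg mP) w = 4 * C.wch mN mP w := by
  rw [C.wch_deltaAvg]
  simp only [Pi.add_apply]
  rw [C.wch_comp_delta hl hu mN mP, C.wch_comp_delta2 hl hu mN mP, C.wch_comp_delta3 hl hu mN mP,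
    twistW_pow_mul_of_classScreen h, twistW_pow_mul_of_classScreen h, twistW_pow_mul_of_classScreen h]
  ring

/-- **CLASS-LEVEL ORBIT-BLINDNESS (the typed obstruction to `G₁`-orbit-breaking at class level):** on a `G₁`-closed support, EVERY integer
weighted design whose class tensor passes (A1) has the SAME class tensor, up to the factor `96 = |G₁|`, as its `G₁`-AVERAGED (orbit-constant)
design `g1Avg`. Hence every class-level row, functional or word — THEOREM LC's `(h, m₁, μ′)`, MSIGN `m₁ ≤ −1`, `|μ|`, C5∕LF∕PO∕c₈ — takes on
the non-constant design the value it takes on an ORBIT-CONSTANT INTEGER design divided by 96: a class-level word computed on orbit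
variables decides all multiplicity patterns (up to the scale, see `lattice_exponent` for the sharp denominator). -/
theorem wch_g1Avg_of_classScreen (C : MConfig) (hlΔ : DeltaClosed C.lower) (huΔ : DeltaClosed C.upper) (hl : PermClosed C.lower)
    (hu : PermClosed C.upper) (mN mP : MCell → ℤ) (h : ClassScreen (C.wch mN mP)) (w : CWord) :
    C.wch (g1Avg mN) (g1Avg mP) w = 96 * C.wch mN mP w := by
  have h' : ClassScreen (C.wch (permAvg mN) (permAvg mP)) := C.classScreen_permAvg hl hu mN mP h
  show C.wch (deltaAvg (permAvg mN)) (deltaAvg (permAvg mP)) w = _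
  rw [wch_deltaAvg_of_classScreen C hlΔ huΔ _ _ h', wch_permAvg_of_classScreen C hl hu _ _ h]
  ring

/-- … in particular the `G₁`-average of a clean design is clean with ALL class data scaled by 96 (functional form, for citing). -/
theorem wch_g1Avg_eq_smul (C : MConfig) (hlΔ : DeltaClosed C.lower) (huΔ : DeltaClosed C.upper) (hl : PermClosed C.lower)
    (hu : PermClosed C.upper) (mN mP : MCell → ℤ) (h : ClassScreen (C.wch mN mP)) :
    C.wch (g1Avg mN) (g1Avg mP) = fun w => 96 * C.wch mN mP w :=
  funext fun w => wch_g1Avg_of_classScreen C hlΔ huΔ hl hu mN mP h w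

/-- the class screen is closed under constant multiples (a linear gate). -/
theorem classScreen_const_mul {R : Type*} [MulZeroClass R] (c : R) {T : CWord → R} (hT : ClassScreen T) :
    ClassScreen fun w => c * T w :=
  ⟨fun w hw hwe hwb => by simp only [hT.1 w hw hwe hwb, mul_zero], fun w w' hw hw' hd => by simp only [hT.2 w w' hw hw' hd]⟩

/-! ### §2b The `G₁`-CLOSED proviso is droppable at class level: a design on ANY support is shadowed on its `G₁`-hull -/

/-- iterating Δ on a cell acts factorwise by iterating `deltaPt`. -/
theorem delta_iterate_apply (n : ℕ) (Y : MCell) (f : Fin 4) : (MCell.delta^[n] Y) f = deltaPt^[n] (Y f) := by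
  induction n generalizing Y with
  | zero => rfl
  | succ n ih => simp only [Function.iterate_succ_apply, ih]; rfl

/-- the diagonal phase `cvec k` is the `k`-th iterate of Δ. -/
theorem phase_cvec_eq_iterate (k : Fin 4) (Y : MCell) : Y.phase (cvec k) = MCell.delta^[k.val] Y := by
  funext f
  rw [delta_iterate_apply]
  exact phasePt_eq_iterate k (Y f)

/-- the Δ-average is constant along Δ-iterates. -/
theorem deltaAvg_iterate (p : MCell → ℤ) (n : ℕ) (Y : MCell) : deltaAvg p (MCell.delta^[n] Y) = deltaAvg p Y := by
  induction n with
  | zero => rfl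
  | succ n ih => rw [Function.iterate_succ_apply', deltaAvg_delta, ih]

/-- a non-negative weight is dominated by its Δ-average. -/
theorem le_deltaAvg (p : MCell → ℤ) (hp0 : ∀ Z, 0 ≤ p Z) (Y : MCell) : p Y ≤ deltaAvg p Y := by
  have h1 := hp0 Y.delta; have h2 := hp0 Y.delta.delta; have h3 := hp0 Y.delta.delta.delta
  unfold deltaAvg; omega

/-- the `S₄`-average of a non-negative weight is positive at every permutation of a cell where the weight is positive. -/
theorem permAvg_pos_of_perm (m : MCell → ℤ) (hm0 : ∀ Z, 0 ≤ m Z) {X : MCell} (hX : 0 < m X) (τ : Equiv.Perm (Fin 4)) :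
    0 < permAvg m (X.perm τ) := by
  have hle : m ((X.perm τ).perm τ⁻¹) ≤ permAvg m (X.perm τ) :=
    Finset.single_le_sum (f := fun σ => m ((X.perm τ).perm σ)) (fun σ _ => hm0 _) (Finset.mem_univ τ⁻¹)
  rw [MCell.perm_perm_inv] at hle
  exact lt_of_lt_of_le hX hle

/-- on one level: the `G₁`-average of a weight `≥ 0` everywhere and `> 0` on `S` is `> 0` on the whole `G₁`-saturation of `S`. -/
theorem g1Avg_pos_on_satLevel (S : Finset MCell) (m : MCell → ℤ) (hm0 : ∀ Z, 0 ≤ m Z) (hm : ∀ X ∈ S, 0 < m X) (Z : MCell)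
    (hZ : Z ∈ univ.biUnion fun k => (univ.biUnion fun τ => S.image (MCell.perm τ)).image (MCell.phase (cvec k))) :
    0 < g1Avg m Z := by
  obtain ⟨k, Y, hY, rfl⟩ := (mem_sat_iff _ _ Z).mp hZ
  obtain ⟨τ, X, hX, rfl⟩ := (mem_sat_iff _ _ _).mp hY
  have hp0 : ∀ W, 0 ≤ permAvg m W := fun W => Finset.sum_nonneg fun σ _ => hm0 _
  have key : 0 < permAvg m (X.perm τ) := permAvg_pos_of_perm m hm0 (hm X hX) τ
  show 0 < deltaAvg (permAvg m) ((X.perm τ).phase (cvec k))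
  rw [phase_cvec_eq_iterate, deltaAvg_iterate]
  exact lt_of_lt_of_le key (le_deltaAvg _ hp0 _)

/-- **HULL POSITIVITY:** a weight `≥ 0` everywhere and `≥ 1` on the support `C` has `G₁`-average `≥ 1` on the whole `G₁`-HULL `satG1 C`
(both levels) — a design on a NON-`G₁`-closed support is, after averaging, a FULL-SUPPORT orbit-constant design on the hull. -/
theorem g1Avg_pos_on_hull (C : MConfig) (mN mP : MCell → ℤ) (hN0 : ∀ Z, 0 ≤ mN Z) (hP0 : ∀ P, 0 ≤ mP P)
    (hN : ∀ Z ∈ C.lower, 0 < mN Z) (hP : ∀ P ∈ C.upper, 0 < mP P) :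
    (∀ Z ∈ (satG1 C).lower, 0 < g1Avg mN Z) ∧ ∀ P ∈ (satG1 C).upper, 0 < g1Avg mP P :=
  ⟨fun Z hZ => g1Avg_pos_on_satLevel C.lower mN hN0 hN Z hZ, fun P hP' => g1Avg_pos_on_satLevel C.upper mP hP0 hP P hP'⟩

/-- **THE `G₁`-CLOSED ∕ ORBIT-CONSTANT PROVISO IS WLOG AT CLASS LEVEL (hull form of the tree's `g1Invariant_wlog`):** let `C` be ANY two-level
support (not necessarily `G₁`-closed) and `H = satG1 C` its `G₁`-hull (tree: `G₁`-closed, RULE D(μ₄) and the diamond kept, `C ⊆ H`). Integer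
weights `≥ 0` on the cells, `≥ 1` on `C`, whose class tensor over `H` passes (A1) with `μ ≠ 0`, yield the `G₁`-INVARIANT weights `g1Avg` that are
`≥ 1` on ALL of `H`, pass (A1), have `μ ≠ 0`, and have class tensor EXACTLY `96 ×` the original. So every class-level word of record stated
for orbit-constant designs on `G₁`-closed static supports holds, rescaled, for arbitrary multiplicities on arbitrary sub-supports with that hull. -/
theorem hull_orbitConstant_wlog (C : MConfig) (mN mP : MCell → ℤ) (hN0 : ∀ Z, 0 ≤ mN Z) (hP0 : ∀ P, 0 ≤ mP P)
    (hN : ∀ Z ∈ C.lower, 0 < mN Z) (hP : ∀ P ∈ C.upper, 0 < mP P) (h : ClassScreen ((satG1 C).wch mN mP))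
    (hμ : (satG1 C).wch mN mP eWord ≠ 0) :
    (∀ Z, g1Avg mN Z.delta = g1Avg mN Z) ∧ (∀ σ Z, g1Avg mN (MCell.perm σ Z) = g1Avg mN Z) ∧
      (∀ P, g1Avg mP P.delta = g1Avg mP P) ∧ (∀ σ P, g1Avg mP (MCell.perm σ P) = g1Avg mP P) ∧
      (∀ Z ∈ (satG1 C).lower, 0 < g1Avg mN Z) ∧ (∀ P ∈ (satG1 C).upper, 0 < g1Avg mP P) ∧
      ClassScreen ((satG1 C).wch (g1Avg mN) (g1Avg mP)) ∧ (satG1 C).wch (g1Avg mN) (g1Avg mP) eWord ≠ 0 ∧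
      (satG1 C).wch (g1Avg mN) (g1Avg mP) = fun w => 96 * (satG1 C).wch mN mP w := by
  obtain ⟨hl, hu, hlΔ, huΔ⟩ := g1Closed_satG1 C
  have hpos := g1Avg_pos_on_hull C mN mP hN0 hP0 hN hP
  have e := wch_g1Avg_eq_smul (satG1 C) hlΔ huΔ hl hu mN mP h
  refine ⟨fun Z => deltaAvg_delta _ Z, fun σ Z => deltaAvg_permInvariant _ (permAvg_perm mN) σ Z, fun P => deltaAvg_delta _ P,
    fun σ P => deltaAvg_permInvariant _ (permAvg_perm mP) σ P, hpos.1, hpos.2, ?_, ?_, e⟩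
  · rw [e]; exact classScreen_const_mul 96 h
  · rw [e]; exact mul_ne_zero (by decide) hμ

/-- (idea-crit-6 g12 PRICE P3, bus l.6806) a bigger configuration has the SAME weighted class tensor for weights ZERO-EXTENDED off `C`. -/
theorem wch_eq_of_sub_of_zero_off {C D : MConfig} (hCD : C.sub D) (mN mP : MCell → ℤ)
    (hN : ∀ Z, Z ∉ C.lower → mN Z = 0) (hP : ∀ P, P ∉ C.upper → mP P = 0) :
    D.wch mN mP = C.wch mN mP := by
  unfold MConfig.wch
  rw [← Finset.sum_subset hCD.1 (fun Z _ hZ => by rw [hN Z hZ, zero_smul]),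
    ← Finset.sum_subset hCD.2 (fun P _ hP' => by rw [hP P hP', zero_smul])]

/-- in particular on the `G₁`-hull: `(satG1 C).wch m = C.wch m` for weights vanishing off `C` (so the hypotheses of
`hull_orbitConstant_wlog` are the design's OWN (A1)-cleanliness and `μ ≠ 0`). -/
theorem wch_satG1_eq_of_zero_off (C : MConfig) (mN mP : MCell → ℤ)
    (hN : ∀ Z, Z ∉ C.lower → mN Z = 0) (hP : ∀ P, P ∉ C.upper → mP P = 0) :
    (satG1 C).wch mN mP = C.wch mN mP :=
  wch_eq_of_sub_of_zero_off (sub_satG1 C) mN mP hN hP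

/-- **HULL WLOG, design form** (P3 discharged): a design with weights `> 0` exactly on `C` and `0` off `C`, (A1)-clean with `μ ≠ 0`
FOR ITS OWN TENSOR `C.wch`, averages to an orbit-constant, full-support, clean, `μ ≠ 0` design on the hull `satG1 C` with tensor `96 • C.wch`. -/
theorem hull_orbitConstant_wlog' (C : MConfig) (mN mP : MCell → ℤ) (hN0 : ∀ Z, 0 ≤ mN Z) (hP0 : ∀ P, 0 ≤ mP P)
    (hN : ∀ Z ∈ C.lower, 0 < mN Z) (hP : ∀ P ∈ C.upper, 0 < mP P)
    (hNoff : ∀ Z, Z ∉ C.lower → mN Z = 0) (hPoff : ∀ P, P ∉ C.upper → mP P = 0)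
    (h : ClassScreen (C.wch mN mP)) (hμ : C.wch mN mP eWord ≠ 0) :
    (∀ Z, g1Avg mN Z.delta = g1Avg mN Z) ∧ (∀ σ Z, g1Avg mN (MCell.perm σ Z) = g1Avg mN Z) ∧
      (∀ P, g1Avg mP P.delta = g1Avg mP P) ∧ (∀ σ P, g1Avg mP (MCell.perm σ P) = g1Avg mP P) ∧
      (∀ Z ∈ (satG1 C).lower, 0 < g1Avg mN Z) ∧ (∀ P ∈ (satG1 C).upper, 0 < g1Avg mP P) ∧
      ClassScreen ((satG1 C).wch (g1Avg mN) (g1Avg mP)) ∧ (satG1 C).wch (g1Avg mN) (g1Avg mP) eWord ≠ 0 ∧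
      (satG1 C).wch (g1Avg mN) (g1Avg mP) = fun w => 96 * C.wch mN mP w := by
  have e0 := wch_satG1_eq_of_zero_off C mN mP hNoff hPoff
  have H := hull_orbitConstant_wlog C mN mP hN0 hP0 hN hP (e0 ▸ h) (by rw [e0]; exact hμ)
  rw [e0] at H
  exact H

/-! WHY `G₁` AND NOT THE PHASE TORUS (cited, tree): a factorwise phase `η` twists the μ-word by `twistT η eeee`, which is `1` iff
`DetOne η` (`Pad4TowerPhaseTorus.twistT_eWord_eq_one_iff`) — off the determinant-one subtorus μ is only SEMI-invariant, so averaging over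
the full torus KILLS μ (`apply_avg_eq_zero_of_semi`) instead of preserving it: the symmetrisation group of the census is `G₁ = ⟨Δ⟩ × S₄`
(`|G₁| = 96`; the determinant-one phases beyond Δ change the SUPPORT's letters and are LEMMA T's business, not a symmetry of a fixed design). -/

end ClassLevel

/-! ## §3 Support level: the `G₁`-hull of a support keeps RULE D(μ₄) and the diamond (tree, LEMMA P part 2) — the support of the shadow -/

section SupportLevel

open Summit.Ventures.HSemireg.Pad4Tower

/-- the support of the Reynolds shadow of a design supported on `C` is (contained in) the `G₁`-hull `satG1 C`; by the tree's LEMMA P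
(part 2) that hull is `G₁`-closed, RULE-D(μ₄)-closed when `C` is, and in the same diamond — so at SUPPORT level orbit-breaking can matter
only through the non-monotone static families X⁺ ∕ A2I⁻ (no hull statement is claimed for them). This is a re-export for the card. -/
theorem hull_keeps_ruleD_and_diamond (C : MConfig) (hD : RuleDMu4Closed C) {h : ℤ} (hU : C.InDiamond h) :
    (satG1 C).G1Closed ∧ RuleDMu4Closed (satG1 C) ∧ (satG1 C).InDiamond h ∧ C.sub (satG1 C) :=
  ⟨g1Closed_satG1 C, ruleDMu4Closed_satG1 hD, inDiamond_satG1 hU, sub_satG1 C⟩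

end SupportLevel

end Summit.HodgeConjecture.HodgeConjecture.Cruxes.BlochSeedDiscOne.OrbitMassShadow
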